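import Summits.Ventures.AbcSig.Rows.XTemplateHalves
import Summits.Ventures.AbcSig.Levels.N10016
import Summits.Ventures.AbcSig.Rows.C2aL313A3yodd
import Summits.Ventures.AbcSig.Levels.N10016M4C23K1

/-!
# Venture AbcSig — PARITY-HALF ROW `C2aL313A3yodd`: `xⁿ + 8·313^m·yⁿ = z²`, `y` odd (class `a = 3`, clean level only) over the NORM-FORM level file 10016 = 32·313 (GENERATED by p-lean g4 `gen4/halfrow.py`)

K-VARIANT (p-lean g7 `gen7/kpatch.py`): the CITED module-M4 hypotheses for the pairs 10016.1 @ 23 (tree orbit indices) are replaced by the KERNEL class-by-class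
Kraus discharges of `Levels/N…M4C….lean` (`gen7/m4cgen.py`: class tables = `Recipes/KrausTable.lean` values = the census certificates' `S_q_mod_n`; mod-n
certificates by `decide +kernel`) under the COMPUTED same-newforms hypotheses `hM_…` and the named hypotheses `hK_…` (`RefinedTraces` per reduced exponent,
CITED recipe [BS04 p. 27 + (3.1), Kra97] + COMPUTED table). Every other hypothesis and the conclusion are those of `Rows/C2aL313A3yodd.lean` verbatim (this file is a WRAPPER: the row of record is applied unchanged).
HONEST FRAMING. A row of a COMPUTATION cell (`pub-abcsig`); a CONDITIONAL theorem, no claim on ABC or any summit.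
Hypotheses: `BS04Package` (CITED: [BS04] Lemma 3.3 + (3.1) + Lemma 4.2); `DataComplete 10016` + `RefinesCPSymAll 10016` (COMPUTED:
certified engine-1 level file; norm-form certificates `Sieve/CharpolyCert.lean`, prime-ideal trees where the norm form is weaker);
the listed per-orbit exclusions `hX_…` (CITED: the row of record's module closures — nothing of them is checked here).
Only the parity half living at the single level 32·313 is claimed (the complementary half needs level 2·313, not certified).
Exponent range: prime `n ≥ 11`, `n ≠ 313`; `1 ≤ m < n`.
Residual of record: none. CITED per the row of record's R3: 10016.1 @ 23: M4; 10016.9 @ 17: M4/M6c-old.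
Row of record: `census/rows/C2a/C2a-l313-a3-yodd.md` (sha16 `7520f0e02f1271e3`; SIGNED 2026-08-22T16:05:08Z by referee (ref-g11)).
-/

namespace Summit.Ventures.AbcSig

/-- K-VARIANT of `xrow_C2aL313A3yodd` (module-M4 citations replaced by kernel class-table discharges, see the file docstring): Parity-half row `C2aL313A3yodd` (`xⁿ + 8·313^m·yⁿ = z²`, `y` odd (class `a = 3`, clean level only)); prime `n ≥ 11`, `n ≠ 313`; conditional on the named hypotheses. -/
theorem xrow_C2aL313A3yoddK (M : NewformModel)
    (hP : M.BS04Package)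
    (hD10016 : M.DataComplete 10016 level10016Orbits)
    (hCP10016 : M.RefinesCPSymAll 10016 level10016CP)
    (n : ℕ)
    (hn : n.Prime)
    (hmin : 11 ≤ n)
    (hnℓ : n ≠ 313)
    (m : ℕ)
    (hm : 1 ≤ m)
    (hmn : m < n)
    (hM_10016_1 : ∀ f : M.Form 10016, M.Matches f orbit_10016_1 → M.Matches f m4cX_10016_1_n23)
    (hK_10016_1 : ∀ m : ℕ, 1 ≤ m → m < 23 → M.RefinedTraces (famB (2 ^ 3 * 313 ^ m) 23 (fun _ _ => True)) (m4cTab_a3_10016_1_n23 m))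
    (hX_orbit_10016_9 : n ∈ ([17] : List ℕ) → M.Excludes 10016 orbit_10016_9
      (famB (2 ^ 3 * 313 ^ m) n (fun _ _ => True)))
    (x y z : ℤ)
    (hy : ¬ 2 ∣ y)
    (hxy1 : x * y ≠ 1)
    (hxy2 : x * y ≠ -1) : ¬ IsPrimitiveSolution 1 (2 ^ 3 * 313 ^ m) 1 n x y z :=
  xrow_C2aL313A3yodd M hP hD10016 hCP10016 n hn hmin hnℓ m hm hmn (fun hmem => by
      obtain rfl : n = 23 := by simpa using hmem
      exact orbit_10016_1_exclM4_a3_23 M hM_10016_1 hK_10016_1 m hm hmn) hX_orbit_10016_9 x y z hy hxy1 hxy2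

end Summit.Ventures.AbcSig
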